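import Summits.QuantumFields.BalabanUV.T4Continuum.Support.DirichletRelativeBesov

/-!
# `BalabanUV.T4Continuum.Support.DirichletRelativeBesovIntrinsic` — NE2 (node U1a) formalisation swarm, sub-row `T4-U1a.S-NE2-D1-DIRICHLET°`,
# supplier item «Δ1-SKELETON» (file 1): gen 3's one-sided Besov END under smoothness hypotheses that are INTRINSIC TO THE REGION —
# first differences of the cutoff only along bonds with BOTH ends in `Ω`, pure second differences only along triples INSIDE `Ω`
# (unit b2b-balaban-t4-ne2-formalise-leaf-08, gen 7, file 1)

HONEST FRAMING.  Rung (B)+1 bookkeeping at MODEL level, finite torus; [folklore] finite lattice calculus; NE2 (U1a) is NOT proved by this file;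
spine PROVED 0/9 unchanged; NOT infinite volume, NOT the mass gap, NOT Clay.  HONEST DEPENDENCY (verbatim): «continuum YM on T⁴ ⇐ BetaPertH ∧
nine spine estimates (0/9 proved); BetaPertH ⇐ (D1) ∧ (D4) ∧ CAP+tail; G-an2-4 gates asym, D1 and NE2/3/4.»

WHY.  Gen 5's relative structure `DirichletRelativeBesov.RelSmooth Ω z ψ ℓ₁ ℓ₂` asks, at a site `x ∈ Ω` near the support of `z`, for the
bounds `|ψ(x ± e_ν) − ψ x| ≤ ℓ₁`, `|2ψ x − ψ(x+e_ν) − ψ(x−e_ν)| ≤ ℓ₂` INVOLVING THE VALUES OF `ψ` AT EXTERIOR NEIGHBOURS `x ± e_ν ∉ Ω`.  At a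
«checkerboard» codimension-2 cell of a block region (blocks `B`, `B + e_μ + e_ν ∈ S`, `B + e_μ`, `B + e_ν ∉ S`) this is UNSATISFIABLE for an
admissible `μ`-cutoff (`ψ = 1` on the top sites of `B`, `ψ = 0` on the bottom sites of `B + e_μ + e_ν`, and the exterior corner site of
`B + e_ν` is a neighbour of both), although the region is locally DISCONNECTED there and the one-sided method has no conflict.  The
exterior values are an artefact of the bookkeeping: in the Laplacian commutator `Δ(ψz) − ψΔz = |c|² Σ_ν Σ_± (ψ(x) − ψ(x ± e_ν))·z(x ± e_ν)` a
term with `x ± e_ν ∉ Ω` VANISHES (`z = 0` there), and when exactly one `μ`-neighbour is exterior the surviving term is a FIRST difference of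
`ψ` along an `Ω`-bond times a DIFFERENCE of `z` (paid by the energy).  THIS FILE records the weaker [shape] structure **`RelSmoothIn Ω z ψ ℓ₁ ℓ₂`**
(values in `[0,1]`; `|ψ(x+e_ν) − ψ x| ≤ ℓ₁` only if `x, x+e_ν ∈ Ω`; `|2ψ x − ψ(x+e_ν) − ψ(x−e_ν)| ≤ ℓ₂` only if `x, x ± e_ν ∈ Ω`; both only
near the support of `z`, as in gen 5), proves `RelSmooth → RelSmoothIn`, `RelSmoothIn.compl`, the commutator bound
**`sqrt_nsq_restrict_LapS_cut_le_in`** with gen 3's right-hand side VERBATIM, and THE END **`nsq_sdiff_sdiff_le_in`** ∕ **`nsq_sdiffH_sdiff_le_in`**: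
for `z` supported in `Ω`, `ψ` intrinsically smooth w.r.t. `z` and admissible along `μ` where `z ≠ 0`,
`‖∂_μ∂_μ z‖² ≤ 8‖c‖·√(2E(z) + 2d‖c‖²ℓ₁²‖z‖²)·(‖1_ΩΔz‖ + Σ_ν(2‖c‖ℓ₁‖∂_νz‖ + ‖c‖²ℓ₂‖z‖))` (0 sorry).  It is the form of H-D that the
generic Ω-intrinsic cutoffs of the item «Δ1-SKELETON» (blockwise dips, discontinuous across gaps the region does not bridge) satisfy.

ABSOLUTE RULE (cell, verbatim): «No internally-minted statement may enter as a cited fact. Every hypothesis is either kernel-proved in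
this package or a verbatim quotation of a PUBLISHED theorem with page reference. The manuscript(s) under audit are NOT citable for
their own disputed steps — they are the thing under adjudication; programme-internal (2001/route/tribunal) claims are never citable.»
[folklore]; one parametrised hypothesis STRUCTURE on data; no `def … : Prop` fact.  NOT CLAIMED: any cutoff construction, anything at the
residue; NE2; NE3.
-/

noncomputable section

open scoped BigOperators ComplexConjugate Matrix
open Finset

namespace Summit.QuantumFields.BalabanUV.T4Continuum.DirichletRelativeBesovIntrinsic

open Literature.MathematicalPhysics.QuantumFieldTheory.Balaban1983to89.B5Prop11Plancherel (Tor unitVec)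
open Literature.MathematicalPhysics.QuantumFieldTheory.Balaban1983to89.B5Action121 (sdiff LapS sdiff_mulVec LapS_mulVec)
open Literature.MathematicalPhysics.QuantumFieldTheory.Balaban1983to89.B5Prop11Lower (nsq nsq_nonneg)
open Summit.QuantumFields.BalabanUV.T4Continuum.ScalarBlockPoincare (nsq_add_le nsq_smul transS nsq_transS)
open Summit.QuantumFields.BalabanUV.T4Continuum.DirichletDirectionalBesov
open Summit.QuantumFields.BalabanUV.T4Continuum.DirichletDirectionalBesovCutoff (cut energy transl_sub_transl_eq
  cut_add_cut_compl nsq_sdiffH_sdiff_eq LapS_cut norm_ofReal_le_one)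
open Summit.QuantumFields.BalabanUV.T4Continuum.DirichletRelativeBesov (RelSmooth energy_cut_le_rel admissible_pos_rel admissible_neg_rel)

variable {d : ℕ} (N : Fin d → ℕ) [hN : ∀ μ, NeZero (N μ)]

/-! ## §1 The intrinsic smoothness structure -/

/-- [shape] **SMOOTHNESS OF THE CUTOFF INTRINSIC TO THE REGION `Ω` AND RELATIVE TO THE FIELD `z`**: values in `[0,1]`; first differences
bounded only along bonds with BOTH ends in `Ω`, pure second differences only along triples `x − e_ν, x, x + e_ν` INSIDE `Ω`, and both only
at sites `ν`-adjacent to the support of `z`.  Exterior values of `ψ` are never looked at. [folklore] -/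
structure RelSmoothIn (Ω : Tor N → Prop) (z : Tor N → ℂ) (ψ : Tor N → ℝ) (ℓ₁ ℓ₂ : ℝ) : Prop where
  nonneg : ∀ x, 0 ≤ ψ x
  le_one : ∀ x, ψ x ≤ 1
  ell1_nonneg : 0 ≤ ℓ₁
  ell2_nonneg : 0 ≤ ℓ₂
  lip : ∀ x (ν : Fin d), Ω x → (z x ≠ 0 ∨ z (x + unitVec N ν) ≠ 0 ∨ z (x - unitVec N ν) ≠ 0) →
    (Ω (x + unitVec N ν) → |ψ (x + unitVec N ν) - ψ x| ≤ ℓ₁) ∧ (Ω (x - unitVec N ν) → |ψ x - ψ (x - unitVec N ν)| ≤ ℓ₁)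
  lip₂ : ∀ x (ν : Fin d), Ω x → Ω (x + unitVec N ν) → Ω (x - unitVec N ν) →
    (z x ≠ 0 ∨ z (x + unitVec N ν) ≠ 0 ∨ z (x - unitVec N ν) ≠ 0) → |2 * ψ x - ψ (x + unitVec N ν) - ψ (x - unitVec N ν)| ≤ ℓ₂

namespace RelSmoothIn

variable {N} {Ω : Tor N → Prop} {z : Tor N → ℂ} {ψ : Tor N → ℝ} {ℓ₁ ℓ₂ : ℝ}

omit hN in
/-- gen 5's relative structure gives intrinsic smoothness. [folklore] -/
theorem of_relSmooth (h : RelSmooth N Ω z ψ ℓ₁ ℓ₂) : RelSmoothIn N Ω z ψ ℓ₁ ℓ₂ where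
  nonneg := h.nonneg
  le_one := h.le_one
  ell1_nonneg := h.ell1_nonneg
  ell2_nonneg := h.ell2_nonneg
  lip x ν hx hz := ⟨fun _ => (h.lip x ν hx hz).1, fun _ => (h.lip x ν hx hz).2⟩
  lip₂ x ν hx _ _ hz := h.lip₂ x ν hx hz

omit hN in
/-- intrinsic smoothness passes to the complementary cutoff `1 − ψ`. [folklore] -/
theorem compl (h : RelSmoothIn N Ω z ψ ℓ₁ ℓ₂) : RelSmoothIn N Ω z (fun y => 1 - ψ y) ℓ₁ ℓ₂ where
  nonneg x := by linarith [h.le_one x]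
  le_one x := by linarith [h.nonneg x]
  ell1_nonneg := h.ell1_nonneg
  ell2_nonneg := h.ell2_nonneg
  lip x ν hx hz := by
    obtain ⟨h1, h2⟩ := h.lip x ν hx hz
    constructor
    · intro hy
      rw [show (1 - ψ (x + unitVec N ν)) - (1 - ψ x) = -(ψ (x + unitVec N ν) - ψ x) by ring, abs_neg]; exact h1 hy
    · intro hy
      rw [show (1 - ψ x) - (1 - ψ (x - unitVec N ν)) = -(ψ x - ψ (x - unitVec N ν)) by ring, abs_neg]; exact h2 hy
  lip₂ x ν hx hp hm hz := by
    rw [show 2 * (1 - ψ x) - (1 - ψ (x + unitVec N ν)) - (1 - ψ (x - unitVec N ν))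
        = -(2 * ψ x - ψ (x + unitVec N ν) - ψ (x - unitVec N ν)) by ring, abs_neg]
    exact h.lip₂ x ν hx hp hm hz

omit hN in
/-- weaken the constants. [folklore] -/
theorem mono (h : RelSmoothIn N Ω z ψ ℓ₁ ℓ₂) {ℓ₁' ℓ₂' : ℝ} (h1 : ℓ₁ ≤ ℓ₁') (h2 : ℓ₂ ≤ ℓ₂') : RelSmoothIn N Ω z ψ ℓ₁' ℓ₂' where
  nonneg := h.nonneg
  le_one := h.le_one
  ell1_nonneg := h.ell1_nonneg.trans h1
  ell2_nonneg := h.ell2_nonneg.trans h2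
  lip x ν hx hz := ⟨fun hy => ((h.lip x ν hx hz).1 hy).trans h1, fun hy => ((h.lip x ν hx hz).2 hy).trans h1⟩
  lip₂ x ν hx hp hm hz := (h.lip₂ x ν hx hp hm hz).trans h2

omit hN in
/-- restrict the field: intrinsic smoothness w.r.t. `z` gives it w.r.t. any field with smaller support. [folklore] -/
theorem of_support {z' : Tor N → ℂ} (h : RelSmoothIn N Ω z ψ ℓ₁ ℓ₂) (hz' : ∀ x, z x = 0 → z' x = 0) : RelSmoothIn N Ω z' ψ ℓ₁ ℓ₂ where
  nonneg := h.nonneg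
  le_one := h.le_one
  ell1_nonneg := h.ell1_nonneg
  ell2_nonneg := h.ell2_nonneg
  lip x ν hx hz := h.lip x ν hx (by
    rcases hz with h0 | h0 | h0
    · exact Or.inl fun hh => h0 (hz' _ hh)
    · exact Or.inr (Or.inl fun hh => h0 (hz' _ hh))
    · exact Or.inr (Or.inr fun hh => h0 (hz' _ hh)))
  lip₂ x ν hx hp hm hz := h.lip₂ x ν hx hp hm (by
    rcases hz with h0 | h0 | h0
    · exact Or.inl fun hh => h0 (hz' _ hh)
    · exact Or.inr (Or.inl fun hh => h0 (hz' _ hh))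
    · exact Or.inr (Or.inr fun hh => h0 (hz' _ hh)))

end RelSmoothIn

/-! ## §2 Energy of a cut field -/

/-- **energy of a cut field** under intrinsic smoothness: `E(ψz) ≤ 2E(z) + 2d‖c‖²ℓ₁²‖z‖²` (for `z` supported in `Ω`; a bond carrying `z` at
both ends lies inside `Ω`). [folklore] -/
theorem energy_cut_le_in {Ω : Tor N → Prop} (c : ℂ) {ψ : Tor N → ℝ} {ℓ₁ ℓ₂ : ℝ} {z : Tor N → ℂ}
    (h : RelSmoothIn N Ω z ψ ℓ₁ ℓ₂) (hz : ∀ x, ¬ Ω x → z x = 0) :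
    energy N c (cut N ψ z) ≤ 2 * energy N c z + 2 * d * ‖c‖ ^ 2 * ℓ₁ ^ 2 * nsq z := by
  unfold energy nsq
  have hpt : ∀ ν x, ‖(sdiff N c ν *ᵥ cut N ψ z) x‖ ^ 2 ≤ 2 * ‖(sdiff N c ν *ᵥ z) x‖ ^ 2 + 2 * ‖c‖ ^ 2 * ℓ₁ ^ 2 * ‖z x‖ ^ 2 :=
    fun ν x => DirichletRelativeBesov.norm_sdiff_cut_sq_le N c ν h.nonneg h.le_one z x fun hzx hzy =>
      (h.lip x ν (by by_contra hx; exact hzx (hz x hx)) (Or.inl hzx)).1 (by by_contra hy; exact hzy (hz _ hy))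
  calc ∑ ν, ∑ x, ‖(sdiff N c ν *ᵥ cut N ψ z) x‖ ^ 2 ≤ ∑ ν : Fin d, ∑ x, (2 * ‖(sdiff N c ν *ᵥ z) x‖ ^ 2 + 2 * ‖c‖ ^ 2 * ℓ₁ ^ 2 * ‖z x‖ ^ 2) :=
        Finset.sum_le_sum fun ν _ => Finset.sum_le_sum fun x _ => hpt ν x
    _ = 2 * ∑ ν, ∑ x, ‖(sdiff N c ν *ᵥ z) x‖ ^ 2 + 2 * d * ‖c‖ ^ 2 * ℓ₁ ^ 2 * ∑ x, ‖z x‖ ^ 2 := by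
        simp only [Finset.sum_add_distrib, ← Finset.mul_sum, Finset.sum_const, Finset.card_univ, Fintype.card_fin, nsmul_eq_mul]; ring

/-! ## §3 The compressed Laplacian of a cut field: the intrinsic commutator -/

section Commutator

variable (Ω : Tor N → Prop) [DecidablePred Ω] (ψ : Tor N → ℝ) (z : Tor N → ℂ)

/-- the INTRINSIC first-difference coefficient of the commutator at `x` along `ν`: `ψ x − ψ(x+e_ν)` if `x + e_ν ∈ Ω`, else
`ψ(x−e_ν) − ψ x` if `x − e_ν ∈ Ω`, else `0`; and `0` off `Ω` or away from the support of `z`. [folklore] -/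
def alphaIn (ν : Fin d) (x : Tor N) : ℝ :=
  if Ω x ∧ (z x ≠ 0 ∨ z (x + unitVec N ν) ≠ 0 ∨ z (x - unitVec N ν) ≠ 0) then
    (if Ω (x + unitVec N ν) then ψ x - ψ (x + unitVec N ν)
     else if Ω (x - unitVec N ν) then ψ (x - unitVec N ν) - ψ x else 0)
  else 0

/-- the INTRINSIC second-difference coefficient: `2ψ x − ψ(x+e_ν) − ψ(x−e_ν)` only on triples inside `Ω` near the support of `z`. [folklore] -/
def betaIn (ν : Fin d) (x : Tor N) : ℝ :=
  if Ω x ∧ (z x ≠ 0 ∨ z (x + unitVec N ν) ≠ 0 ∨ z (x - unitVec N ν) ≠ 0) ∧ Ω (x + unitVec N ν) ∧ Ω (x - unitVec N ν) then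
    2 * ψ x - ψ (x + unitVec N ν) - ψ (x - unitVec N ν)
  else 0

variable {Ω ψ z}

omit hN in
/-- `|α| ≤ ℓ₁` under intrinsic smoothness. [folklore] -/
theorem abs_alphaIn_le {ℓ₁ ℓ₂ : ℝ} (h : RelSmoothIn N Ω z ψ ℓ₁ ℓ₂) (ν : Fin d) (x : Tor N) : |alphaIn N Ω ψ z ν x| ≤ ℓ₁ := by
  unfold alphaIn
  split_ifs with hcond hp hm
  · rw [abs_sub_comm]; exact (h.lip x ν hcond.1 hcond.2).1 hp
  · rw [abs_sub_comm]; exact (h.lip x ν hcond.1 hcond.2).2 hm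
  · rw [abs_zero]; exact h.ell1_nonneg
  · rw [abs_zero]; exact h.ell1_nonneg

omit hN in
/-- `|β| ≤ ℓ₂` under intrinsic smoothness. [folklore] -/
theorem abs_betaIn_le {ℓ₁ ℓ₂ : ℝ} (h : RelSmoothIn N Ω z ψ ℓ₁ ℓ₂) (ν : Fin d) (x : Tor N) : |betaIn N Ω ψ z ν x| ≤ ℓ₂ := by
  unfold betaIn
  split_ifs with hcond
  · exact h.lip₂ x ν hcond.1 hcond.2.2.1 hcond.2.2.2 hcond.2.1
  · rw [abs_zero]; exact h.ell2_nonneg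

omit hN in
/-- **the pointwise commutator identity, intrinsic form**: at a site `x ∈ Ω`, for `z` supported in `Ω`, the `ν`-term of `Δ(ψz) − ψΔz` equals
`α·(z(x+e_ν) − z(x−e_ν)) + β·z(x−e_ν)` with the intrinsic coefficients. [folklore] -/
theorem comm_term_eq (hz : ∀ x, ¬ Ω x → z x = 0) (ν : Fin d) {x : Tor N} (hx : Ω x) :
    ((ψ x - ψ (x + unitVec N ν) : ℝ) : ℂ) * (z (x + unitVec N ν) - z (x - unitVec N ν))
        + ((2 * ψ x - ψ (x + unitVec N ν) - ψ (x - unitVec N ν) : ℝ) : ℂ) * z (x - unitVec N ν)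
      = ((alphaIn N Ω ψ z ν x : ℝ) : ℂ) * (z (x + unitVec N ν) - z (x - unitVec N ν)) + ((betaIn N Ω ψ z ν x : ℝ) : ℂ) * z (x - unitVec N ν) := by
  unfold alphaIn betaIn
  by_cases hnb : z x ≠ 0 ∨ z (x + unitVec N ν) ≠ 0 ∨ z (x - unitVec N ν) ≠ 0
  · by_cases hp : Ω (x + unitVec N ν)
    · by_cases hm : Ω (x - unitVec N ν)
      · rw [if_pos ⟨hx, hnb⟩, if_pos hp, if_pos ⟨hx, hnb, hp, hm⟩]
      · have h0 : z (x - unitVec N ν) = 0 := hz _ hm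
        rw [if_pos ⟨hx, hnb⟩, if_pos hp, if_neg (fun h => hm h.2.2.2), h0]
        push_cast; ring
    · have h0 : z (x + unitVec N ν) = 0 := hz _ hp
      by_cases hm : Ω (x - unitVec N ν)
      · rw [if_pos ⟨hx, hnb⟩, if_neg hp, if_pos hm, if_neg (fun h => hp h.2.2.1), h0]
        push_cast; ring
      · have h1 : z (x - unitVec N ν) = 0 := hz _ hm
        rw [if_pos ⟨hx, hnb⟩, if_neg hp, if_neg hm, if_neg (fun h => hp h.2.2.1), h0, h1]
        push_cast; ring
  · push Not at hnb
    obtain ⟨h1, h2, h3⟩ := hnb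
    have hneg : ¬ (Ω x ∧ (z x ≠ 0 ∨ z (x + unitVec N ν) ≠ 0 ∨ z (x - unitVec N ν) ≠ 0)) := fun h =>
      h.2.elim (fun h' => h' h1) (fun h' => h'.elim (fun h'' => h'' h2) (fun h'' => h'' h3))
    have hneg' : ¬ (Ω x ∧ (z x ≠ 0 ∨ z (x + unitVec N ν) ≠ 0 ∨ z (x - unitVec N ν) ≠ 0) ∧ Ω (x + unitVec N ν) ∧ Ω (x - unitVec N ν)) :=
      fun h => hneg ⟨h.1, h.2.1⟩
    rw [if_neg hneg, if_neg hneg', h2, h3]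
    push_cast; ring

/-- **the commutator bound under INTRINSIC smoothness**: for `z` supported in `Ω`,
`‖1_Ω·Δ(ψz)‖ ≤ ‖1_Ω·Δz‖ + Σ_ν (2‖c‖ℓ₁‖∂_νz‖ + ‖c‖²ℓ₂‖z‖)` — gen 3's right-hand side verbatim. [folklore] -/
theorem sqrt_nsq_restrict_LapS_cut_le_in (c : ℂ) (hc : c ≠ 0) {ℓ₁ ℓ₂ : ℝ} (h : RelSmoothIn N Ω z ψ ℓ₁ ℓ₂) (hz : ∀ x, ¬ Ω x → z x = 0) :
    Real.sqrt (nsq (restrictTo Ω (LapS N c *ᵥ cut N ψ z)))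
      ≤ Real.sqrt (nsqOn Ω (LapS N c *ᵥ z))
        + ∑ ν, (2 * ‖c‖ * ℓ₁ * Real.sqrt (nsq (sdiff N c ν *ᵥ z)) + ‖c‖ ^ 2 * ℓ₂ * Real.sqrt (nsq z)) := by
  have hc0 : 0 < ‖c‖ := norm_pos_iff.mpr hc
  have hℓ₁ := h.ell1_nonneg
  have hℓ₂ := h.ell2_nonneg
  set S : Tor N → ℂ := ∑ ν, (conj c * c) • ((fun x => ((alphaIn N Ω ψ z ν x : ℝ) : ℂ) * (z (x + unitVec N ν) - z (x - unitVec N ν)))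
            + (fun x => ((betaIn N Ω ψ z ν x : ℝ) : ℂ) * z (x - unitVec N ν))) with hS
  have hdec : restrictTo Ω (LapS N c *ᵥ cut N ψ z) = cut N ψ (restrictTo Ω (LapS N c *ᵥ z)) + restrictTo Ω S := by
    funext x
    rw [LapS_cut]
    simp only [restrictTo, cut, Pi.add_apply, hS, Finset.sum_apply, Pi.smul_apply, smul_eq_mul]
    by_cases hx : Ω x
    · simp only [if_pos hx]
      congr 1
      exact Finset.sum_congr rfl fun ν _ => by rw [comm_term_eq N hz ν hx]
    · simp [if_neg hx]
  rw [hdec]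
  refine (sqrt_nsq_add_le _ _).trans (add_le_add ?_ ?_)
  · calc Real.sqrt (nsq (cut N ψ (restrictTo Ω (LapS N c *ᵥ z)))) ≤ 1 * Real.sqrt (nsq (restrictTo Ω (LapS N c *ᵥ z))) :=
          sqrt_nsq_mul_le zero_le_one (fun x => norm_ofReal_le_one N h.nonneg h.le_one x) _
      _ = Real.sqrt (nsqOn Ω (LapS N c *ᵥ z)) := by rw [one_mul, nsq_restrictTo]
  · have hαb : ∀ ν x, ‖((alphaIn N Ω ψ z ν x : ℝ) : ℂ)‖ ≤ ℓ₁ := fun ν x => by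
      rw [Complex.norm_real, Real.norm_eq_abs]; exact abs_alphaIn_le N h ν x
    have hβb : ∀ ν x, ‖((betaIn N Ω ψ z ν x : ℝ) : ℂ)‖ ≤ ℓ₂ := fun ν x => by
      rw [Complex.norm_real, Real.norm_eq_abs]; exact abs_betaIn_le N h ν x
    calc Real.sqrt (nsq (restrictTo Ω S)) ≤ Real.sqrt (nsq S) := sqrt_nsq_mono (norm_restrictTo_le Ω S)
      _ ≤ ∑ ν, Real.sqrt (nsq ((conj c * c) • ((fun x => ((alphaIn N Ω ψ z ν x : ℝ) : ℂ) * (z (x + unitVec N ν) - z (x - unitVec N ν)))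
            + (fun x => ((betaIn N Ω ψ z ν x : ℝ) : ℂ) * z (x - unitVec N ν))))) := sqrt_nsq_sum_le _ _
      _ ≤ ∑ ν, (2 * ‖c‖ * ℓ₁ * Real.sqrt (nsq (sdiff N c ν *ᵥ z)) + ‖c‖ ^ 2 * ℓ₂ * Real.sqrt (nsq z)) := by
          refine Finset.sum_le_sum fun ν _ => ?_
          rw [sqrt_nsq_smul, norm_mul, Complex.norm_conj, ← sq]
          have hA : Real.sqrt (nsq (fun x => ((alphaIn N Ω ψ z ν x : ℝ) : ℂ) * (z (x + unitVec N ν) - z (x - unitVec N ν))))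
              ≤ ℓ₁ * (‖c‖⁻¹ * (2 * Real.sqrt (nsq (sdiff N c ν *ᵥ z)))) := by
            refine (sqrt_nsq_mul_le hℓ₁ (hαb ν) _).trans (mul_le_mul_of_nonneg_left ?_ hℓ₁)
            rw [transl_sub_transl_eq N c hc ν z, sqrt_nsq_smul, norm_inv]
            refine mul_le_mul_of_nonneg_left ((sqrt_nsq_add_le _ _).trans ?_) (inv_nonneg.mpr hc0.le)
            rw [nsq_transS, two_mul]
          have hB : Real.sqrt (nsq (fun x => ((betaIn N Ω ψ z ν x : ℝ) : ℂ) * z (x - unitVec N ν))) ≤ ℓ₂ * Real.sqrt (nsq z) := by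
            refine (sqrt_nsq_mul_le hℓ₂ (hβb ν) _).trans (le_of_eq ?_)
            have : (fun x => z (x - unitVec N ν)) = transS N (-unitVec N ν) z := by funext x; simp [transS, sub_eq_add_neg]
            rw [this, nsq_transS]
          calc ‖c‖ ^ 2 * Real.sqrt (nsq ((fun x => ((alphaIn N Ω ψ z ν x : ℝ) : ℂ) * (z (x + unitVec N ν) - z (x - unitVec N ν)))
                + fun x => ((betaIn N Ω ψ z ν x : ℝ) : ℂ) * z (x - unitVec N ν)))
              ≤ ‖c‖ ^ 2 * (ℓ₁ * (‖c‖⁻¹ * (2 * Real.sqrt (nsq (sdiff N c ν *ᵥ z)))) + ℓ₂ * Real.sqrt (nsq z)) :=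
                mul_le_mul_of_nonneg_left ((sqrt_nsq_add_le _ _).trans (add_le_add hA hB)) (sq_nonneg _)
            _ = 2 * ‖c‖ * ℓ₁ * Real.sqrt (nsq (sdiff N c ν *ᵥ z)) + ‖c‖ ^ 2 * ℓ₂ * Real.sqrt (nsq z) := by field_simp

end Commutator

/-! ## §4 THE END under intrinsic hypotheses -/

/-- **ONE CUT PIECE** under intrinsic smoothness: `‖∂_μ∂_μ(φz)‖² ≤ 2‖c‖·√(2E(z) + 2d‖c‖²ℓ₁²‖z‖²)·(‖1_ΩΔz‖ + Σ_ν(2‖c‖ℓ₁‖∂_νz‖ + ‖c‖²ℓ₂‖z‖))`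
for any intrinsically smooth `φ` whose piece translates inside `Ω`. [folklore] -/
theorem nsq_sdiff_sdiff_cut_le_in {Ω : Tor N → Prop} [DecidablePred Ω] (c : ℂ) (hc : c ≠ 0) (μ : Fin d) {v : Tor N}
    (hv : v = unitVec N μ ∨ v = -unitVec N μ) {φ : Tor N → ℝ} {ℓ₁ ℓ₂ : ℝ} {z : Tor N → ℂ} (hφ : RelSmoothIn N Ω z φ ℓ₁ ℓ₂)
    (hz : ∀ x, ¬ Ω x → z x = 0) (hadm : ∀ x, ¬ Ω x → (transS N v (cut N φ z) - cut N φ z) x = 0) :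
    nsq (sdiff N c μ *ᵥ (sdiff N c μ *ᵥ cut N φ z))
      ≤ 2 * ‖c‖ * Real.sqrt (2 * energy N c z + 2 * d * ‖c‖ ^ 2 * ℓ₁ ^ 2 * nsq z)
          * (Real.sqrt (nsqOn Ω (LapS N c *ᵥ z))
              + ∑ ν, (2 * ‖c‖ * ℓ₁ * Real.sqrt (nsq (sdiff N c ν *ᵥ z)) + ‖c‖ ^ 2 * ℓ₂ * Real.sqrt (nsq z))) := by
  have hmain := nsq_sdiff_sdiff_le_of_admissible N c hc μ hv (cut N φ z) (restrictTo Ω (LapS N c *ᵥ cut N φ z)) hadm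
    (fun x hx => by simp [restrictTo, hx])
  have hE : Real.sqrt (∑ ν, nsq (sdiff N c ν *ᵥ cut N φ z)) ≤ Real.sqrt (2 * energy N c z + 2 * d * ‖c‖ ^ 2 * ℓ₁ ^ 2 * nsq z) :=
    Real.sqrt_le_sqrt (energy_cut_le_in N c hφ hz)
  have hR := sqrt_nsq_restrict_LapS_cut_le_in N c hc hφ hz
  have hc0 : 0 ≤ 2 * ‖c‖ := by positivity
  calc nsq (sdiff N c μ *ᵥ (sdiff N c μ *ᵥ cut N φ z))
      ≤ 2 * ‖c‖ * Real.sqrt (∑ ν, nsq (sdiff N c ν *ᵥ cut N φ z)) * Real.sqrt (nsq (restrictTo Ω (LapS N c *ᵥ cut N φ z))) := hmain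
    _ ≤ 2 * ‖c‖ * Real.sqrt (2 * energy N c z + 2 * d * ‖c‖ ^ 2 * ℓ₁ ^ 2 * nsq z)
          * (Real.sqrt (nsqOn Ω (LapS N c *ᵥ z))
              + ∑ ν, (2 * ‖c‖ * ℓ₁ * Real.sqrt (nsq (sdiff N c ν *ᵥ z)) + ‖c‖ ^ 2 * ℓ₂ * Real.sqrt (nsq z))) :=
        mul_le_mul (mul_le_mul_of_nonneg_left hE hc0) hR (Real.sqrt_nonneg _) (mul_nonneg hc0 (Real.sqrt_nonneg _))

/-- **THE END UNDER INTRINSIC HYPOTHESES**: for `z` supported in `Ω`, a cutoff `ψ` intrinsically smooth w.r.t. `z` on `Ω` and admissible along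
`μ` WHERE `z ≠ 0`, `‖∂_μ∂_μ z‖² ≤ 8‖c‖·√(2E(z) + 2d‖c‖²ℓ₁²‖z‖²)·(‖1_ΩΔz‖ + Σ_ν(2‖c‖ℓ₁‖∂_νz‖ + ‖c‖²ℓ₂‖z‖))` — gen 3's bound verbatim.
[folklore] -/
theorem nsq_sdiff_sdiff_le_in {Ω : Tor N → Prop} [DecidablePred Ω] {μ : Fin d} {ψ : Tor N → ℝ} {ℓ₁ ℓ₂ : ℝ} {z : Tor N → ℂ}
    (hψ : RelSmoothIn N Ω z ψ ℓ₁ ℓ₂) (hzero : ∀ x, Ω x → ¬ Ω (x - unitVec N μ) → z x ≠ 0 → ψ x = 0)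
    (hone : ∀ x, Ω x → ¬ Ω (x + unitVec N μ) → z x ≠ 0 → ψ x = 1) (c : ℂ) (hc : c ≠ 0) (hz : ∀ x, ¬ Ω x → z x = 0) :
    nsq (sdiff N c μ *ᵥ (sdiff N c μ *ᵥ z))
      ≤ 8 * ‖c‖ * Real.sqrt (2 * energy N c z + 2 * d * ‖c‖ ^ 2 * ℓ₁ ^ 2 * nsq z)
          * (Real.sqrt (nsqOn Ω (LapS N c *ᵥ z))
              + ∑ ν, (2 * ‖c‖ * ℓ₁ * Real.sqrt (nsq (sdiff N c ν *ᵥ z)) + ‖c‖ ^ 2 * ℓ₂ * Real.sqrt (nsq z))) := by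
  have hP := nsq_sdiff_sdiff_cut_le_in N (Ω := Ω) c hc μ (Or.inl rfl) hψ hz (admissible_pos_rel N hzero hz)
  have hM := nsq_sdiff_sdiff_cut_le_in N (Ω := Ω) c hc μ (Or.inr rfl) hψ.compl hz (admissible_neg_rel N hone hz)
  have hsplit : sdiff N c μ *ᵥ (sdiff N c μ *ᵥ z)
      = sdiff N c μ *ᵥ (sdiff N c μ *ᵥ cut N ψ z) + sdiff N c μ *ᵥ (sdiff N c μ *ᵥ cut N (fun y => 1 - ψ y) z) := by
    rw [← Matrix.mulVec_add, ← Matrix.mulVec_add, cut_add_cut_compl]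
  rw [hsplit]
  refine (nsq_add_le _ _).trans ?_
  linarith

/-- **THE END, adjoint-sandwich form** `‖∂_μᴴ∂_μ z‖² ≤ …` (the (C-glob) input). [folklore] -/
theorem nsq_sdiffH_sdiff_le_in {Ω : Tor N → Prop} [DecidablePred Ω] {μ : Fin d} {ψ : Tor N → ℝ} {ℓ₁ ℓ₂ : ℝ} {z : Tor N → ℂ}
    (hψ : RelSmoothIn N Ω z ψ ℓ₁ ℓ₂) (hzero : ∀ x, Ω x → ¬ Ω (x - unitVec N μ) → z x ≠ 0 → ψ x = 0)
    (hone : ∀ x, Ω x → ¬ Ω (x + unitVec N μ) → z x ≠ 0 → ψ x = 1) (c : ℂ) (hc : c ≠ 0) (hz : ∀ x, ¬ Ω x → z x = 0) :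
    nsq ((sdiff N c μ)ᴴ *ᵥ (sdiff N c μ *ᵥ z))
      ≤ 8 * ‖c‖ * Real.sqrt (2 * energy N c z + 2 * d * ‖c‖ ^ 2 * ℓ₁ ^ 2 * nsq z)
          * (Real.sqrt (nsqOn Ω (LapS N c *ᵥ z))
              + ∑ ν, (2 * ‖c‖ * ℓ₁ * Real.sqrt (nsq (sdiff N c ν *ᵥ z)) + ‖c‖ ^ 2 * ℓ₂ * Real.sqrt (nsq z))) := by
  rw [nsq_sdiffH_sdiff_eq N c hc]
  exact nsq_sdiff_sdiff_le_in N hψ hzero hone c hc hz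

/-- CONSISTENCY (kernel): gen 5's relative END is the special case of a relatively smooth cutoff. -/
example {Ω : Tor N → Prop} [DecidablePred Ω] {μ : Fin d} {ψ : Tor N → ℝ} {ℓ₁ ℓ₂ : ℝ} {z : Tor N → ℂ} (hψ : RelSmooth N Ω z ψ ℓ₁ ℓ₂)
    (hzero : ∀ x, Ω x → ¬ Ω (x - unitVec N μ) → z x ≠ 0 → ψ x = 0) (hone : ∀ x, Ω x → ¬ Ω (x + unitVec N μ) → z x ≠ 0 → ψ x = 1)
    (c : ℂ) (hc : c ≠ 0) (hz : ∀ x, ¬ Ω x → z x = 0) :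
    nsq (sdiff N c μ *ᵥ (sdiff N c μ *ᵥ z))
      ≤ 8 * ‖c‖ * Real.sqrt (2 * energy N c z + 2 * d * ‖c‖ ^ 2 * ℓ₁ ^ 2 * nsq z)
          * (Real.sqrt (nsqOn Ω (LapS N c *ᵥ z))
              + ∑ ν, (2 * ‖c‖ * ℓ₁ * Real.sqrt (nsq (sdiff N c ν *ᵥ z)) + ‖c‖ ^ 2 * ℓ₂ * Real.sqrt (nsq z))) :=
  nsq_sdiff_sdiff_le_in N (RelSmoothIn.of_relSmooth hψ) hzero hone c hc hz

end Summit.QuantumFields.BalabanUV.T4Continuum.DirichletRelativeBesovIntrinsic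

end
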